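import Summits.QuantumFields.GaugeBoot.TiltedBoxLimitDiagonalRP
import Summits.QuantumFields.GaugeBoot.TiltedBoxLimitAxisRP
import Summits.QuantumFields.GaugeBoot.TiltedBoxLimitHaarShift
import HarnessLib

/-!
# Infinite-volume limit points of the 45°-tilted boxes, part 7: the tilted class is inhabited at every coupling

HONEST FRAMING (cell `pub-gaugeboot`, page 1 of every file): the venture produces certified bounds
on lattice expectations at stated coupling, gauge group, dimension and torus size; NOT a mass gap,
NOT a continuum limit, NOT a string tension; NOT Yang–Mills-summit-bearing (barriers
`FixedCouplingUltralocality`, `PerturbativeInvisibility`). This module packages structural facts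
about a class of infinite-volume Wilson states (which SDP constraints are exact for them, and that
the class is non-empty); it discharges nothing else.

## Content

`ClassB.lean` isolates the properties of an infinite-volume state that a loop-equation SDP with all
THREE reflection-positivity families consumes (`ClassBState`: invariances, Haar-shift identity,
site/link/diagonal RP along every axis and plane) and records that INHABITATION of that class is
open at weak coupling in `d ≥ 3` (tribunal ruling R8: a Class-B certificate there is a conditional
theorem; the cubic tori lose diagonal RP, the free boxes lose translation invariance).

The limit points of the square 45°-tilted boxes (`tiltedBoxLimitPoints d i j ρ β`, parts 1–6 of this
series) carry a smaller but still useful list of these properties, collected here as the structure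
**`TiltedClassState d i j ρ β`** ("Class T" of the tilted plane `(i, j)`): probability, translation
invariance, invariance under the transposition `(i j)` and under every coordinate reflection, the
one-link Haar-shift identity (hence the loop equations), DIAGONAL reflection positivity in the plane
`x_i = x_j`, and site and link reflection positivity along every axis `k ∉ {i, j}`.

* **`exists_tiltedClassState_of_mem_tiltedBoxLimitPoints`** — every tilted limit point is the
  measure of a `TiltedClassState` (`β ≥ 0`, `i ≠ j`);
* **`nonempty_tiltedClassState`** — hence Class T is INHABITED for every compact Hausdorff second
  countable `G`, every continuous `ρ`, every `β ≥ 0`, every `d` and every pair `i ≠ j`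
  (`tiltedBoxLimitPoints_nonempty`) — unconditionally, with no uniqueness or strong-coupling
  hypothesis;
* **`ClassBState.toTiltedClassState`** — every Class-B state is a Class-T state; so a certificate
  for an SDP using only the Class-T constraints (Gram/`H` blocks from the Haar-shift loop equations,
  the symmetry reductions above, `R_diag(i, j)`, `R_site(k)`, `R_link(k)` for `k ∉ {i, j}`) proves its
  bound SIMULTANEOUSLY for every tilted limit point and for every Class-B state, and the first family
  is never empty.

NOT claimed: axis (site/link) reflection positivity along `i` or `j`, diagonal RP in the other
planes, or invariance under permutations moving `i`, `j` — for tilted limit points these are open here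
(on the finite boxes the in-plane axis mirrors are symmetries NOT of positive type,
`TiltedBoxAxisRPNegative.lean` ff.); nor the DLR property beyond the one-link identity; nor any
relation between `tiltedBoxLimitPoints` and the cubic `infiniteVolumeLimitPoints` (equal under Gibbs
uniqueness, not shown here). Class T is a device for stating what a tilted-box certificate means in
infinite volume; it is not a physical selection principle.

References: J. Fröhlich, R. Israel, E. H. Lieb, B. Simon, J. Stat. Phys. 22 (1980) 297, §3;
K. Osterwalder, E. Seiler, Ann. Phys. 110 (1978) 440, §2; V. Kazakov, Z. Zheng, arXiv:2203.11360 §3.1,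
arXiv:2404.16925 §3.2; S. Friedli, Y. Velenik (2017) Ch. 10.
-/

noncomputable section

open MeasureTheory Filter Topology
open scoped ComplexOrder ComplexConjugate
open Literature.Probability.LatticeModels (Site)
open Literature.MathematicalPhysics.QuantumLattice

namespace Summit.QuantumFields.GaugeBoot

namespace TiltedRP

variable {G : Type*} [Group G] [TopologicalSpace G] [MeasurableSpace G]

variable (d : ℕ) (i j : Fin d) {N : ℕ} (ρ : G →* Matrix (Fin N) (Fin N) ℂ) in
/-- **Class-T state** of the tilted plane `(i, j)` (representation `ρ`, Wilson action, coupling `β`):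
a probability measure on the gauge configurations of the INFINITE lattice `ℤ^d` which is translation
invariant, invariant under the axis transposition `(i j)` and under every coordinate reflection,
obeys the one-link Haar-shift (Gibbs) identity of the Wilson action, and is reflection positive in
the diagonal hyperplane `x_i = x_j` and in the site and link hyperplanes orthogonal to every axis
`k ∉ {i, j}` — exactly the constraints a loop-equation SDP on the 45°-tilted family may use and keep
exact in infinite volume. Every `ClassBState` is one (`ClassBState.toTiltedClassState`) and every
tilted limit point is one (`exists_tiltedClassState_of_mem_tiltedBoxLimitPoints`), so the class is
inhabited at every `β ≥ 0` (`nonempty_tiltedClassState`). [shape] A structure of hypotheses — NOT a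
fact. [folklore] -/
structure TiltedClassState (β : ℝ) where
  /-- the state, a measure on `ℤ^d` gauge configurations -/
  μ : Measure (LGConfig d G)
  /-- it is a probability measure -/
  isProbabilityMeasure : IsProbabilityMeasure μ
  /-- invariance under lattice translations -/
  translationInvariant : IsZdTranslationInvariant μ
  /-- invariance under the transposition of the axes `i`, `j` -/
  swapInvariant : MeasurePreserving (configPerm (Equiv.swap i j)) μ μ
  /-- invariance under the coordinate reflections `x_m ↦ -x_m`, every axis `m` -/
  reflectInvariant : ∀ m : Fin d, MeasurePreserving (configSiteReflect m) μ μ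
  /-- the one-link Gibbs (Haar-shift) identity of the Wilson action at coupling `β` -/
  haarShift : IsHaarShiftState ρ β μ
  /-- reflection positivity in the diagonal hyperplane `x_i = x_j` -/
  diagRP : IsReflectionPositiveFor (configDiagSwapZd i j) (diagHalfEdges i j) μ
  /-- reflection positivity in the site hyperplanes `x_k = 0`, `k ∉ {i, j}` -/
  siteRP : ∀ k : Fin d, k ≠ i → k ≠ j →
    IsReflectionPositiveFor (configSiteReflect k) (siteHalfEdges k) μ
  /-- reflection positivity in the link hyperplanes `x_k = ½`, `k ∉ {i, j}` -/
  linkRP : ∀ k : Fin d, k ≠ i → k ≠ j →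
    IsReflectionPositiveFor (configLinkReflect k) (linkHalfEdges k) μ

/-- **Every Class-B state is a Class-T state** (for every pair `i ≠ j`; in fact for every pair): the
Class-T constraints are a sublist of the Class-B constraints. -/
def _root_.Summit.QuantumFields.GaugeBoot.ClassBState.toTiltedClassState {d N : ℕ}
    {ρ : G →* Matrix (Fin N) (Fin N) ℂ} {β : ℝ} (ω : ClassBState d ρ β) (i j : Fin d) (hij : i ≠ j) :
    TiltedClassState d i j ρ β where
  μ := ω.μ
  isProbabilityMeasure := ω.isProbabilityMeasure
  translationInvariant := ω.translationInvariant
  swapInvariant := ω.permInvariant (Equiv.swap i j)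
  reflectInvariant := ω.reflectInvariant
  haarShift := ω.haarShift
  diagRP := ω.diagRP i j hij
  siteRP k _ _ := ω.siteRP k
  linkRP k _ _ := ω.linkRP k

variable {d : ℕ} {i j : Fin d} {N : ℕ} [IsTopologicalGroup G] [CompactSpace G] [BorelSpace G]
  [SecondCountableTopology G] [T2Space G]
variable (ρ : G →* Matrix (Fin N) (Fin N) ℂ)

/-- **Every tilted limit point is a Class-T state** (`i ≠ j`, `β ≥ 0`, compact Hausdorff second
countable `G`, continuous `ρ`): parts 3–6 of this series. -/
def tiltedClassStateOfMem (hij : i ≠ j) (hρ : Continuous ρ) {β : ℝ} (hβ : 0 ≤ β)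
    {μ : Measure (LGConfig d G)} (hμ : μ ∈ tiltedBoxLimitPoints d i j ρ β) :
    TiltedClassState d i j ρ β where
  μ := μ
  isProbabilityMeasure := isProbabilityMeasure_of_mem_tiltedBoxLimitPoints hμ
  translationInvariant := isZdTranslationInvariant_of_mem_tiltedBoxLimitPoints ρ hρ hμ
  swapInvariant := measurePreserving_configPerm_swap_of_mem_tiltedBoxLimitPoints ρ hij hρ hμ
  reflectInvariant := reflectInvariant_of_mem_tiltedBoxLimitPoints ρ hij hρ hμ
  haarShift := isHaarShiftState_of_mem_tiltedBoxLimitPoints ρ hρ hμ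
  diagRP := diagRP_of_mem_tiltedBoxLimitPoints ρ hij hρ hβ hμ
  siteRP _ hki hkj := siteRP_of_mem_tiltedBoxLimitPoints ρ hki hkj hij hρ hβ hμ
  linkRP _ hki hkj := linkRP_of_mem_tiltedBoxLimitPoints ρ hki hkj hρ hβ hμ

/-- The Class-T state of a tilted limit point has that limit point as its measure. -/
@[simp] theorem tiltedClassStateOfMem_μ (hij : i ≠ j) (hρ : Continuous ρ) {β : ℝ} (hβ : 0 ≤ β)
    {μ : Measure (LGConfig d G)} (hμ : μ ∈ tiltedBoxLimitPoints d i j ρ β) :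
    (tiltedClassStateOfMem ρ hij hρ hβ hμ).μ = μ := rfl

/-- **Every tilted limit point is the measure of a Class-T state.** -/
theorem exists_tiltedClassState_of_mem_tiltedBoxLimitPoints (hij : i ≠ j) (hρ : Continuous ρ)
    {β : ℝ} (hβ : 0 ≤ β) {μ : Measure (LGConfig d G)} (hμ : μ ∈ tiltedBoxLimitPoints d i j ρ β) :
    ∃ ω : TiltedClassState d i j ρ β, ω.μ = μ :=
  ⟨tiltedClassStateOfMem ρ hij hρ hβ hμ, rfl⟩

/-- **Class T is inhabited at every coupling `β ≥ 0`**, for every compact Hausdorff second countable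
gauge group, every continuous representation, every dimension and every pair of axes `i ≠ j` — with a
tilted limit point as witness (`tiltedBoxLimitPoints_nonempty`). No uniqueness, strong-coupling or
dimensional hypothesis. -/
theorem nonempty_tiltedClassState (hij : i ≠ j) (hρ : Continuous ρ) {β : ℝ} (hβ : 0 ≤ β) :
    Nonempty (TiltedClassState d i j ρ β) := by
  obtain ⟨μ, hμ⟩ := tiltedBoxLimitPoints_nonempty (d := d) (i := i) (j := j) (ρ := ρ) hρ β
  exact ⟨tiltedClassStateOfMem ρ hij hρ hβ hμ⟩

/-- **A Class-T witness which is a tilted limit point** (the form consumed by "for every tilted limit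
point" certificate sentences): there is a tilted limit point, and each one is Class T. -/
theorem exists_mem_tiltedBoxLimitPoints_and_tiltedClassState (hij : i ≠ j) (hρ : Continuous ρ)
    {β : ℝ} (hβ : 0 ≤ β) :
    ∃ μ ∈ tiltedBoxLimitPoints d i j ρ β, ∃ ω : TiltedClassState d i j ρ β, ω.μ = μ := by
  obtain ⟨μ, hμ⟩ := tiltedBoxLimitPoints_nonempty (d := d) (i := i) (j := j) (ρ := ρ) hρ β
  exact ⟨μ, hμ, exists_tiltedClassState_of_mem_tiltedBoxLimitPoints ρ hij hρ hβ hμ⟩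

/-! ## What a Class-T certificate proves -/

namespace TiltedClassState

variable {ρ} {β : ℝ}

omit [IsTopologicalGroup G] [CompactSpace G] [BorelSpace G] [SecondCountableTopology G] [T2Space G] in
/-- **The diagonal RP blocks of a Class-T state are positive semidefinite.** -/
theorem diagBlock_nonneg (ω : TiltedClassState d i j ρ β) {n : ℕ} (F : Fin n → LGConfig d G → ℂ)
    (hF : ∀ a, Measurable (F a)) (hFb : ∀ a, ∃ C : ℝ, ∀ U, ‖F a U‖ ≤ C)
    (hFS : ∀ a, DependsOn (F a) (diagHalfEdges i j)) (c : Fin n → ℂ) :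
    0 ≤ ∑ a, ∑ b, conj (c a) * c b * ∫ U, conj (F a (configDiagSwapZd i j U)) * F b U ∂ω.μ := by
  haveI := ω.isProbabilityMeasure
  exact ω.diagRP.sum_mul_conj_nonneg DiagRP.measurable_configDiagSwapZd F hF hFb hFS c

omit [CompactSpace G] [T2Space G] in
/-- **The site RP blocks along `k ∉ {i, j}` of a Class-T state are positive semidefinite.** -/
theorem siteBlock_nonneg (ω : TiltedClassState d i j ρ β) {k : Fin d} (hki : k ≠ i) (hkj : k ≠ j)
    {n : ℕ} (F : Fin n → LGConfig d G → ℂ) (hF : ∀ a, Measurable (F a))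
    (hFb : ∀ a, ∃ C : ℝ, ∀ U, ‖F a U‖ ≤ C) (hFS : ∀ a, DependsOn (F a) (siteHalfEdges k))
    (c : Fin n → ℂ) :
    0 ≤ ∑ a, ∑ b, conj (c a) * c b * ∫ U, conj (F a (configSiteReflect k U)) * F b U ∂ω.μ := by
  haveI := ω.isProbabilityMeasure
  exact (ω.siteRP k hki hkj).sum_mul_conj_nonneg (measurable_configSiteReflect k) F hF hFb hFS c

omit [CompactSpace G] [T2Space G] in
/-- **The link RP blocks along `k ∉ {i, j}` of a Class-T state are positive semidefinite.** -/
theorem linkBlock_nonneg (ω : TiltedClassState d i j ρ β) {k : Fin d} (hki : k ≠ i) (hkj : k ≠ j)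
    {n : ℕ} (F : Fin n → LGConfig d G → ℂ) (hF : ∀ a, Measurable (F a))
    (hFb : ∀ a, ∃ C : ℝ, ∀ U, ‖F a U‖ ≤ C) (hFS : ∀ a, DependsOn (F a) (linkHalfEdges k))
    (c : Fin n → ℂ) :
    0 ≤ ∑ a, ∑ b, conj (c a) * c b * ∫ U, conj (F a (configLinkReflect k U)) * F b U ∂ω.μ := by
  haveI := ω.isProbabilityMeasure
  exact (ω.linkRP k hki hkj).sum_mul_conj_nonneg (measurable_configLinkReflect k) F hF hFb hFS c

/-- **A bound certified for all Class-T states holds for every tilted limit point and for every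
Class-B state** (`β ≥ 0`, `i ≠ j`): the shape of a Class-T certificate sentence. -/
theorem bound_transfer (hij : i ≠ j) (hρ : Continuous ρ) (hβ : 0 ≤ β) {Φ : LGConfig d G → ℝ}
    {a b : ℝ} (hcert : ∀ ω : TiltedClassState d i j ρ β, a ≤ ∫ U, Φ U ∂ω.μ ∧ ∫ U, Φ U ∂ω.μ ≤ b) :
    (∀ μ ∈ tiltedBoxLimitPoints d i j ρ β, a ≤ ∫ U, Φ U ∂μ ∧ ∫ U, Φ U ∂μ ≤ b) ∧
      ∀ ω : ClassBState d ρ β, a ≤ ∫ U, Φ U ∂ω.μ ∧ ∫ U, Φ U ∂ω.μ ≤ b :=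
  ⟨fun _ hμ => hcert (tiltedClassStateOfMem ρ hij hρ hβ hμ),
    fun ω => hcert (ω.toTiltedClassState i j hij)⟩

end TiltedClassState

end TiltedRP

end Summit.QuantumFields.GaugeBoot
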